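import Summits.BirchSwinnertonDyer.BirchSwinnertonDyer.Theorems.GenusKolyvaginAtTwoMinimalTwinBSDTwoAllDepthCells
import Summits.BirchSwinnertonDyer.BirchSwinnertonDyer.Theorems.GenusKolyvaginAtTwoMinimalTwinBSDTwoEggSplit
import Summits.BirchSwinnertonDyer.BirchSwinnertonDyer.Theorems.GenusKolyvaginAtTwoGenusPrimitiveSupplyAtTwoSilentPrimesNoTwoTorsion
import Summits.BirchSwinnertonDyer.BirchSwinnertonDyer.Theorems.GenusKolyvaginAtTwoGenusPrimitiveSupplyAtTwoPrimeHeegnerTwinRowOne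
import HarnessLib

/-!
# Route `GenusKolyvaginAtTwo`, crux U₂ `MinimalTwinBSDTwo` (stmt-BirchSwinnertonDyer-22985), LINE 23 «twin_swap»: THE EGG ENGINE WITH
# NO IMAGE HYPOTHESIS — silent prime Heegner twins for EVERY `Δ_W > 0` curve with `W(ℚ)[2] = 0` (square `Δ` / `C₃`-image included), so
# U₂ is «wall + rank-zero 2-converse + 2-adic exponent» on ALL of `{Δ < 0} ∪ {Δ > 0, W(ℚ) meets the egg}`

Seat `bsd-line-gk2-p3` g31 (PROVER seat 3/3, cell `bsd-f1-sign2`), `--supports stmt-BirchSwinnertonDyer-22985` (helper; closes nothing).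
THEOREMS ONLY (no definition, no named fact, no `sorry`); standard axioms.  **BSD is NOT proved by this file; U₂, the wall, the
2-converse and EXP± are NOT proved; no item is closed.**  §1–§3 are UNCONDITIONAL; §4–§5 are CONDITIONAL on their displayed hypotheses
(PRINT facts, the rank-zero wall S1, the rank-zero 2-converse CONV₀, the 2-adic exponents EXP±_all).

WHY.  The LINE 23 holder's v1.8 residual is OFF′ = `Δ > 0 ∧ [ρ̄_{W,2} not onto ∨ (¬MeetsEgg ∧ …)]` (crux note `Lines/twin-swap-v16-gk2p2.md`
§4): the egg engine `AllDepth.bsdp_posDisc_egg_of_wall_of_converse_of_exponent_of_facts` (gk2-p2 g25, p776404) asks `ρ̄_{W,2}` ONTO, used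
(only) in the silent-prime supply `GenusKolyTwin.exists_silent_prime_heegnerField` (gk2-p5 g7, witness `c₀·[x,y]`) and, nominally, in the
egg dichotomy `Egg.natCard_selmerGroup_twin_of_silent` (g28; there only to get `W(ℚ)[2] = 0`).  But a rank-one curve with `#Sel₂(W) = 2` has
`W(ℚ)[2] = 0` by the descent count alone, and gk2-p4 g15's `GenusKolyTransp.exists_silent_prime_gt_of_noRationalTwoTorsion` (witness `c₀·τ²`,
`ℓ ≡ −s² (mod 8N_W)`) supplies silent primes `ℓ ≡ 7 (8)`, `ℓ ∤ N_W`, `(−ℓ/p) = 1` at the odd bad `p`, for EVERY `Δ_W > 0` curve with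
`W(ℚ)[2] = 0` — the square-`Δ` (`C₃`-image) locus included.  This file threads that supply through the U₂ egg chain:

* §1 `noRationalTwoTorsion_of_forall_two_smul_eq_zero` (no point of order `2` ⟹ `F1Sign2.NoRationalTwoTorsion`) and
  `noRationalTwoTorsion_of_natCard_selmerGroup_eq_two` (`#Sel₂(W) = 2`, rank `≥ 1`);
  `exists_heegnerField_of_prime_of_jacobiSym` — the prime Heegner field `ℚ(√−ℓ)` of a prime `ℓ ≡ 7 (8)`, `ℓ ∤ N_W`, `(−ℓ/p) = 1` at the
  odd bad `p` (gk2-p5's `GenusKolyTwin.exists_heegnerField_of_prime` with the congruence `ℓ ≡ −1 (p)` weakened to the Jacobi condition):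
  `d_K = −ℓ` odd `≠ −3`, Heegner for `N_W`, `2` split, the two Theorem-B₂ non-squares.
* §2 `natCard_selmerGroup_twin_of_silent_of_noRationalTwoTorsion` — g28's egg dichotomy `(MeetsEgg → #Sel₂(Wd) = 1) ∧ (¬MeetsEgg → = 4)`
  for a silent odd Heegner twin, with `ρ̄_{W,2}` onto REPLACED by `W(ℚ)[2] = 0` (same proof; UNCONDITIONAL).
* §3 **`exists_silentPrime_heegnerField_selmerTrivialTwin_of_meetsEgg`** — `Δ_W > 0`, rank `1`, `#Sel₂(W) = 2`, `MeetsEgg W` ⟹ a silent prime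
  `ℓ`, the Heegner field `ℚ(√−ℓ)` with every K-clause of the route, `2` split, and a GLOBALLY MINIMAL twin `Wd ≅ W^{(−ℓ)}` with `#Sel₂(Wd) = 1`
  (UNCONDITIONAL in rank currency; `…_of_GZK` from `r_an = 1` mod GZK) — NO image hypothesis.
* §4 **`bsdp_posDisc_egg_of_wall_of_converse_of_exponent_of_facts_allImages`** — the egg engine of p776404 §2 VERBATIM minus `ρ̄_{W,2}` onto
  (in the conclusion AND in the exponent hypothesis EXP⁺_all): `BSD₂(W)` for every non-CM globally minimal `W` with `r_an = 1`, `#Sel₂ = 2`,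
  `Δ_W > 0`, `MeetsEgg W`, from S1 + CONV₀ + EXP⁺_all + PRINT.
* (sequel `…EggAllImagesLedger`: with p776404 §1 — `Δ < 0`, already image-free — U₂ off the identity locus from S1 + CONV₀ + EXP⁻_all + EXP⁺_all +
  PRINT, and U₂ BY NAME from the same + ONE residual, the IDENTITY LOCUS «`Δ_W > 0 ∧ ¬MeetsEgg W`»; so the holder's residual OFF′ loses its
  «`ρ̄_{W,2}` not onto» disjunct — the residual of LINE 23 is the identity locus alone.)

HONEST STATUS: helpers; EXP±_all are the BSD₂ content (lossless), CONV₀ = items 19218/19219 + the off-semistable residual, S1 = wall row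
(items 19095–19098 sliced); nothing here is progress on BSD; no item is closed.

References: [Kramer1981] §2 Props. 3, 6, Thm. 1; [MazurRubin2010] Lemma 2.2 (i), Prop. 3.3, Cor. 3.4 (i); [SerreAbelianLadic1968] I §2.2 Cor. 2;
[GrossZagier1986] I (6.3), V §2 (2.2); [GrossLMS1991] §1; [Milne1972ArithmeticAV] §1 Thm. 1; [SilvermanAEC2009] III.2.3, X.4.2; [Cox2013] §1.
-/

set_option autoImplicit false
set_option linter.dupNamespace false -- `Summit.<P>.<Sub>` repeats `BirchSwinnertonDyer` (D-0017)

noncomputable section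

open scoped Classical

open WeierstrassCurve NumberField Literature.NumberTheory.EllipticCurves
  Literature.NumberTheory.EllipticCurves.ModularForms
  Literature.NumberTheory.EllipticCurves.Rank1Residual
  Literature.NumberTheory.QuadraticFields
  Summit.BirchSwinnertonDyer.Rank1Residual
  Summit.BirchSwinnertonDyer.Rank1Residual.AdditivePotMult
  Summit.BirchSwinnertonDyer.Rank1Residual.F1Sign2
  Summit.BirchSwinnertonDyer.BirchSwinnertonDyer.Rank1Residual
  Summit.BirchSwinnertonDyer.BirchSwinnertonDyer.Theorems
  Summit.BirchSwinnertonDyer.BirchSwinnertonDyer.Theorems.GenusExact.TwinSwap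
  Summit.BirchSwinnertonDyer.BirchSwinnertonDyer.Theorems.GenusExact.TwinSwap.Silent

open Summit.BirchSwinnertonDyer.BirchSwinnertonDyer.Theorems.GenusExact.TwinSwap.Ledger.Line25
  (entireLFunction_twist_one_ne_zero_of_rankZeroTwoConverse_of_natCard_selmerGroup_eq_one
    exists_kolyvaginHeegnerData_one_of_nonempty_modularParametrizationData not_isOfFinAddOrder_derivedPoint_one_of_rankOne_of_lValue_ne_zero)
open Summit.BirchSwinnertonDyer.BirchSwinnertonDyer.Theorems.GenusExact.TwinSwap.Silent
  (swappedPairDescentAtTwo_silent_of_facts padicValNat_two_tamagawaProduct_twin_eq_of_discr_eq_neg_prime_of_noRoot)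
open Summit.BirchSwinnertonDyer.BirchSwinnertonDyer.Theorems.GenusExact.TwinSwap.Egg
  (shaTwoTrivial_of_natCard_selmerGroup_eq_two forall_noRoot_of_padicValNat_eq)
open Summit.BirchSwinnertonDyer.BirchSwinnertonDyer.Theorems.GenusKolyTransp (exists_silent_prime_gt_of_noRationalTwoTorsion)

namespace Summit.BirchSwinnertonDyer.BirchSwinnertonDyer.Theorems.GenusExact.TwinSwap.EggAllImages

/-! ## §1 `W(ℚ)[2] = 0` in the cell's currency; the prime Heegner field of a Jacobi-admissible prime -/

/-- **No point of order `2` ⟹ `F1Sign2.NoRationalTwoTorsion`** (a rational point `(x, y)` with `2y + a₁x + a₃ = 0` would be a non-zero point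
killed by `2`).  UNCONDITIONAL. [cite: SilvermanAEC2009, III.2.3 (d)] -/
theorem noRationalTwoTorsion_of_forall_two_smul_eq_zero (W : WeierstrassCurve ℚ) [W.IsElliptic]
    (hT : ∀ P : W.toAffine.Point, 2 • P = 0 → P = 0) : NoRationalTwoTorsion W := by
  rintro x ⟨y, hxy, h2⟩
  have hns : W.toAffine.Nonsingular x y := (Affine.equation_iff_nonsingular (W := W)).mp hxy
  have hP2 : (2 : ℕ) • (Affine.Point.some x y hns : W.toAffine.Point) = 0 := by
    rw [two_nsmul]
    exact Affine.Point.add_self_of_Y_eq (by rw [Affine.negY]; linear_combination h2)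
  exact Affine.Point.some_ne_zero hns (hT _ hP2)

/-- **`#Sel₂(W) = 2` and rank `≥ 1` ⟹ `W(ℚ)[2] = 0`** (descent count `#Sel₂ = 2^rank · #W(ℚ)[2] · #(Ш ⊓ H¹[2])`, g23's
`rank_eq_one_and_sha_primary_eq_zero_of_natCard_selmerGroup_eq_two`).  UNCONDITIONAL. [cite: SilvermanAEC2009, X.4.2] -/
theorem noRationalTwoTorsion_of_natCard_selmerGroup_eq_two (W : WeierstrassCurve ℚ) [W.IsElliptic]
    (hSel : Nat.card (W.selmerGroup 2) = 2) (hrk : 1 ≤ W.mordellWeilRank) : NoRationalTwoTorsion W := by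
  obtain ⟨-, hT, -⟩ := rank_eq_one_and_sha_primary_eq_zero_of_natCard_selmerGroup_eq_two W hSel hrk
  refine noRationalTwoTorsion_of_forall_two_smul_eq_zero W fun P hP ↦ hT P ?_
  convert hP

/-- A nonzero rational with ODD `q`-adic valuation at some prime `q` is not a square in `ℚ`. [folklore] -/
private theorem not_isSquare_of_padicValRat_odd'' {q : ℕ} [Fact q.Prime] {x : ℚ} (hx : x ≠ 0)
    (hodd : Odd (padicValRat q x)) : ¬ IsSquare x := by
  rintro ⟨y, rfl⟩
  have hy : y ≠ 0 := fun h => hx (by rw [h, mul_zero])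
  rw [padicValRat.mul hy hy, ← two_mul] at hodd
  exact (Int.not_odd_iff_even.mpr (even_two_mul _)) hodd

/-- **The Heegner field of a Jacobi-admissible prime.**  For `W/ℚ` globally minimal elliptic and a prime `ℓ ≡ 7 (mod 8)` with `ℓ ∤ N_W` and
`(−ℓ/p) = 1` for every odd prime `p ∣ N_W`: `ℓ ∤ Δ_min(W)`, and there is a number field `K` (`= ℚ(√−ℓ)`) with `d_K = −ℓ`, imaginary
quadratic, `d_K` odd and `≠ −3`, satisfying the Heegner hypothesis for `N_W` (odd `p ∣ N_W`: `(d_K/p) = (−ℓ/p) = 1`; `p = 2`: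
`−ℓ ≡ 1 (mod 8)`), with `2` split, and with `d_K·(−|Δ_W|)`, `d_K·(−2|Δ_W|)` non-squares (their `ℓ`-adic valuation is `1`).  = gk2-p5's
`GenusKolyTwin.exists_heegnerField_of_prime` with the congruence `ℓ ≡ −1 (mod p)` WEAKENED to the Jacobi condition (all the Heegner hypothesis
needs).  UNCONDITIONAL. [cite: GrossLMS1991, §1 (p. 235)] [cite: Cox2013, §1] -/
theorem exists_heegnerField_of_prime_of_jacobiSym (W : WeierstrassCurve ℚ) [W.IsElliptic] [W.IsGloballyMinimal]
    {ℓ : ℕ} (hℓ : ℓ.Prime) (hℓ8 : ℓ % 8 = 7) (hℓN : ¬ ℓ ∣ W.conductorNorm ℤ)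
    (hjac : ∀ p : ℕ, p.Prime → p ∣ W.conductorNorm ℤ → p ≠ 2 → jacobiSym (-(ℓ : ℤ)) p = 1) :
    ¬ (ℓ : ℤ) ∣ minimalDiscriminantInt W ∧
    ∃ (K : Type) (_ : Field K) (_ : NumberField K), IsImaginaryQuadratic K ∧ discr K = -(ℓ : ℤ) ∧ Odd (discr K) ∧
      discr K ≠ -3 ∧ SatisfiesHeegnerHypothesis (W.conductorNorm ℤ) K ∧
      ((Ideal.span {(2 : ℤ)}).primesOver (𝓞 K)).ncard = 2 ∧
      ¬ IsSquare ((discr K : ℚ) * -|W.Δ|) ∧ ¬ IsSquare ((discr K : ℚ) * (-(2 * |W.Δ|))) := by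
  haveI := Fact.mk hℓ
  have hℓ2 : ℓ ≠ 2 := by omega
  have hℓΔ : ¬ (ℓ : ℤ) ∣ minimalDiscriminantInt W := fun h =>
    hℓN (GenusKolyTwin.dvd_conductorNorm_of_dvd_minimalDiscriminantInt W hℓ h)
  -- the field `ℚ(√−ℓ)`
  have hD : ((-(ℓ : ℤ)) % 4 = 1 ∧ Squarefree (-(ℓ : ℤ)) ∧ -(ℓ : ℤ) ≠ 1) ∨
      (4 ∣ -(ℓ : ℤ) ∧ (-(ℓ : ℤ) / 4 % 4 = 2 ∨ -(ℓ : ℤ) / 4 % 4 = 3) ∧ Squarefree (-(ℓ : ℤ) / 4)) := by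
    refine Or.inl ⟨by omega, ?_, by omega⟩
    rw [← Int.squarefree_natAbs]
    simpa using hℓ.squarefree
  obtain ⟨K, _, _, h2, hdisc⟩ := Quadratic.exists_numberField_discr_eq hD
  have hK : IsImaginaryQuadratic K :=
    ⟨h2, Quadratic.isTotallyComplex_of_discr_neg h2 (by rw [hdisc, neg_lt_zero]; exact_mod_cast hℓ.pos)⟩
  have hH : SatisfiesHeegnerHypothesis (W.conductorNorm ℤ) K := by
    intro p hp hpN
    by_cases hp2 : p = 2
    · subst hp2
      exact_mod_cast Quadratic.ncard_primesOver_two_eq_two_of_discr_eq_neg h2 hdisc hℓ8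
    · exact (Quadratic.ncard_primesOver_eq_two_iff_jacobiSym h2 hp hp2).mpr (by rw [hdisc]; exact hjac p hp hpN hp2)
  have h2split : ((Ideal.span {(2 : ℤ)}).primesOver (𝓞 K)).ncard = 2 := by
    exact_mod_cast Quadratic.ncard_primesOver_two_eq_two_of_discr_eq_neg h2 hdisc hℓ8
  -- `ℓ`-adic valuations
  have hℓQ : (ℓ : ℚ) ≠ 0 := by exact_mod_cast hℓ.ne_zero
  have hΔQ : (W.Δ : ℚ) ≠ 0 := W.isUnit_Δ.ne_zero
  have hvΔ : padicValRat ℓ W.Δ = 0 := by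
    rw [← cast_minimalDiscriminantInt W, padicValRat.of_int, Int.natCast_eq_zero, padicValInt.eq_zero_of_not_dvd hℓΔ]
  have hvΔabs : padicValRat ℓ |W.Δ| = 0 := by
    rcases abs_choice W.Δ with h | h
    · rw [h, hvΔ]
    · rw [h, padicValRat.neg, hvΔ]
  have hv2 : padicValRat ℓ (2 : ℚ) = 0 := by
    have h2' : ¬ ℓ ∣ 2 := fun h => by have := Nat.le_of_dvd two_pos h; omega
    rw [show (2 : ℚ) = ((2 : ℕ) : ℚ) by norm_num, padicValRat.of_nat, padicValNat.eq_zero_of_not_dvd h2', Nat.cast_zero]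
  have hy0 : (ℓ : ℚ) * |W.Δ| ≠ 0 := mul_ne_zero hℓQ (abs_ne_zero.mpr hΔQ)
  have hy : padicValRat ℓ ((ℓ : ℚ) * |W.Δ|) = 1 := by
    rw [padicValRat.mul hℓQ (abs_ne_zero.mpr hΔQ), padicValRat.self hℓ.one_lt, hvΔabs, add_zero]
  refine ⟨hℓΔ, K, inferInstance, inferInstance, hK, hdisc, by rw [hdisc, Int.odd_iff]; omega, by rw [hdisc]; omega, hH,
    h2split, ?_, ?_⟩
  · have hx : ((discr K : ℤ) : ℚ) * -|W.Δ| = (ℓ : ℚ) * |W.Δ| := by rw [hdisc]; push_cast; ring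
    rw [hx]
    exact not_isSquare_of_padicValRat_odd'' (q := ℓ) hy0 (by rw [hy]; exact odd_one)
  · have hx : ((discr K : ℤ) : ℚ) * (-(2 * |W.Δ|)) = 2 * ((ℓ : ℚ) * |W.Δ|) := by rw [hdisc]; push_cast; ring
    rw [hx]
    refine not_isSquare_of_padicValRat_odd'' (q := ℓ) (mul_ne_zero two_ne_zero hy0) ?_
    rw [padicValRat.mul two_ne_zero hy0, hy, hv2, zero_add]
    exact odd_one

/-- **Silent prime Heegner fields exist beyond every bound for EVERY `W` with `Δ_W > 0` and `W(ℚ)[2] = 0`** (no hypothesis on the image of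
`ρ̄_{W,2}`; UNCONDITIONAL): a prime `ℓ > b`, `ℓ ≡ 7 (mod 8)`, `ℓ ∤ N_W`, SILENT for `W` (no root of the `2`-division cubic of the minimal model
mod `ℓ`), `F1Sign2.DescAdmissible W (−ℓ)`, and `K = ℚ(√−ℓ)` with every K-clause of the route and `2` split.  gk2-p4 g15's Čebotarev supply
`exists_silent_prime_gt_of_noRationalTwoTorsion` + §1. [cite: SerreAbelianLadic1968, Ch. I §2.2, Cor. 2 (a)] [cite: GrossLMS1991, §1 (p. 235)] -/
theorem exists_silent_prime_heegnerField_of_noRationalTwoTorsion (W : WeierstrassCurve ℚ) [W.IsElliptic] [W.IsGloballyMinimal]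
    (hΔ : 0 < W.Δ) (hT : NoRationalTwoTorsion W) (b : ℕ) :
    ∃ ℓ : ℕ, b < ℓ ∧ ℓ.Prime ∧ ℓ % 8 = 7 ∧ ¬ ℓ ∣ W.conductorNorm ℤ ∧
      (∀ x : ZMod ℓ, 4 * x ^ 3 + ((integralModelInt W).b₂ : ZMod ℓ) * x ^ 2 +
        2 * ((integralModelInt W).b₄ : ZMod ℓ) * x + ((integralModelInt W).b₆ : ZMod ℓ) ≠ 0) ∧
      DescAdmissible W (-(ℓ : ℤ)) ∧
      ∃ (K : Type) (_ : Field K) (_ : NumberField K), IsImaginaryQuadratic K ∧ discr K = -(ℓ : ℤ) ∧ Odd (discr K) ∧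
        discr K ≠ -3 ∧ SatisfiesHeegnerHypothesis (W.conductorNorm ℤ) K ∧
        ((Ideal.span {(2 : ℤ)}).primesOver (𝓞 K)).ncard = 2 ∧
        ¬ IsSquare ((discr K : ℚ) * -|W.Δ|) ∧ ¬ IsSquare ((discr K : ℚ) * (-(2 * |W.Δ|))) := by
  obtain ⟨ℓ, hb, hℓ, hℓ8, hℓN, hjac, hsil⟩ := exists_silent_prime_gt_of_noRationalTwoTorsion W hΔ hT b
  obtain ⟨-, hK⟩ := exists_heegnerField_of_prime_of_jacobiSym W hℓ hℓ8 hℓN hjac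
  exact ⟨ℓ, hb, hℓ, hℓ8, hℓN, hsil, GenusKolyTransp.descAdmissible_neg_prime_of_silent_of_jacobiSym W hℓ hℓ8 hℓN hjac hsil, hK⟩

/-! ## §2 The egg dichotomy for a silent Heegner twin — `W(ℚ)[2] = 0` instead of `ρ̄_{W,2}` onto -/

/-- **THE EGG DECIDES THE SILENT TWIN — NO IMAGE HYPOTHESIS.**  `W/ℚ` globally minimal elliptic with `Δ_W > 0`, `W(ℚ)[2] = 0`, rank `1`,
`#Sel₂(W) = 2`; `K` imaginary quadratic, `d_K` odd, Heegner for `N_W`; `Wd = Cd • W^(d_K)` elliptic and SILENT (`ord₂ C(Wd) = ord₂ C(W)`).  Then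
**`#Sel₂(Wd) = 1` if `W(ℚ)` meets the egg, and `#Sel₂(Wd) = 4` if `W(ℚ) ⊂ W⁰(ℝ)`**.  = g28's `Egg.natCard_selmerGroup_twin_of_silent` (p770721)
with its hypothesis `ρ̄_{W,2}` onto — used there only to produce `W(ℚ)[2] = 0` — replaced by `W(ℚ)[2] = 0` itself; same proof (the cell's Kramer /
Mazur–Rubin rows `GenusKolyArch.eggTwistLawAtTwo_holds`, `…_unram`).  UNCONDITIONAL.
[cite: Kramer1981, §2 Props. 3, 6, Thm. 1] [cite: MazurRubin2010, Thm. 2.7, Cor. 3.4 (i)] [cite: Mazur1972, Cor. 4.4] -/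
theorem natCard_selmerGroup_twin_of_silent_of_noRationalTwoTorsion (W : WeierstrassCurve ℚ) [W.IsElliptic] [W.IsGloballyMinimal]
    {K : Type} [Field K] [NumberField K] (hK : IsImaginaryQuadratic K) (hodd : Odd (discr K))
    (hH : SatisfiesHeegnerHypothesis (W.conductorNorm ℤ) K)
    (hΔ : 0 < W.Δ) (hT : NoRationalTwoTorsion W) (hrk : W.mordellWeilRank = 1) (hSel : Nat.card (W.selmerGroup 2) = 2)
    {Wd : WeierstrassCurve ℚ} [Wd.IsElliptic] (Cd : VariableChange ℚ) (hWd : Cd • W.quadraticTwist (discr K : ℚ) = Wd)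
    (hSil : padicValNat 2 Wd.tamagawaProduct = padicValNat 2 W.tamagawaProduct) :
    (MeetsEgg W → Nat.card (Wd.selmerGroup 2) = 1) ∧ (¬ MeetsEgg W → Nat.card (Wd.selmerGroup 2) = 4) := by
  have hSha : ShaTwoTrivial W := shaTwoTrivial_of_natCard_selmerGroup_eq_two W hSel (le_of_eq hrk.symm)
  have hsilent := forall_noRoot_of_padicValNat_eq W hK hodd hH Cd hWd hSil
  have hmodel : Nat.card (Wd.selmerGroup 2) = twistSelmerTwoCard W (discr K) :=
    GenusKolyTwin.natCard_selmerGroup_model_eq_twistSelmerTwoCard W (NumberField.discr_ne_zero K) Wd ⟨Cd, hWd⟩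
  have hS2 : selmerTwoCard W = 2 := by unfold selmerTwoCard; exact hSel
  have h4 : discr K % 4 = 1 := Quadratic.discr_emod_four_eq_one hK.1 hodd
  rw [hmodel]
  by_cases h8 : discr K % 8 = 1
  · -- `2` split: `-desc`-admissible frame, the Egg Twist Law verbatim
    have h2K := (Quadratic.ncard_primesOver_two_eq_two_iff hK.1).mpr h8
    have hDA : DescAdmissible W (discr K) := GenusKolyTwin.descAdmissible_discr_of_forall_silent W hK hodd hH h2K hsilent
    exact GenusKolyArch.eggTwistLawAtTwo_holds W hΔ hT hrk hSha (discr K) hDA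
  · -- `2` inert: `d_K ≡ 5 (8)`, and `2 ∤ N_W` (else `2` would split), so `W` is good at `2`: the unramified rows
    have h5 : discr K % 8 = 5 := by omega
    have h2N : ¬ 2 ∣ W.conductorNorm ℤ := fun h2N ↦
      h8 ((Quadratic.ncard_primesOver_two_eq_two_iff hK.1).mp (hH 2 Nat.prime_two h2N))
    have hgood2 : ∀ _h : Fact (Nat.Prime 2), W.HasGoodReductionAtPrime 2 := fun _ ↦ by
      by_contra hbad
      exact h2N ((W.dvd_conductorNorm_iff_not_hasGoodReductionAtPrime 2).mpr hbad)
    have hDAU : DescAdmissibleUnram W (discr K) :=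
      GenusKolyTwin.descAdmissibleUnram_discr_of_forall_silent W hK hodd hH h5 hgood2 hsilent
    constructor
    · intro hegg
      have hns := (GenusKolyArch.meetsEgg_iff_exists_localization_inl_ne_zero W hΔ hT hSha).mp hegg
      have h := GenusKolyArch.two_mul_twistSelmerTwoCard_eq_of_exists_unram W hΔ hns hDAU
      omega
    · intro hegg
      have hstrict := GenusKolyArch.forall_mem_selmerGroup_localization_inl_eq_zero_of_not_meetsEgg W hΔ hT hSha hegg
      have h := GenusKolyArch.twistSelmerTwoCard_eq_two_mul_of_strict_unram W hΔ hstrict hDAU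
      omega

/-- **On the egg locus EVERY silent odd Heegner twin is `2`-Selmer-trivial — no image hypothesis.**  UNCONDITIONAL.
[cite: Kramer1981, §2 Prop. 6] [cite: MazurRubin2010, Cor. 3.4 (i)] -/
theorem natCard_selmerGroup_twin_eq_one_of_meetsEgg_of_silent_of_noRationalTwoTorsion (W : WeierstrassCurve ℚ) [W.IsElliptic]
    [W.IsGloballyMinimal] {K : Type} [Field K] [NumberField K] (hK : IsImaginaryQuadratic K) (hodd : Odd (discr K))
    (hH : SatisfiesHeegnerHypothesis (W.conductorNorm ℤ) K)
    (hΔ : 0 < W.Δ) (hT : NoRationalTwoTorsion W) (hrk : W.mordellWeilRank = 1) (hSel : Nat.card (W.selmerGroup 2) = 2)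
    {Wd : WeierstrassCurve ℚ} [Wd.IsElliptic] (Cd : VariableChange ℚ) (hWd : Cd • W.quadraticTwist (discr K : ℚ) = Wd)
    (hSil : padicValNat 2 Wd.tamagawaProduct = padicValNat 2 W.tamagawaProduct) (hegg : MeetsEgg W) :
    Nat.card (Wd.selmerGroup 2) = 1 :=
  (natCard_selmerGroup_twin_of_silent_of_noRationalTwoTorsion W hK hodd hH hΔ hT hrk hSel Cd hWd hSil).1 hegg

/-- **A silent `2`-Selmer-trivial Heegner twin exists ONLY on the egg locus — no image hypothesis.**  UNCONDITIONAL.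
[cite: Kramer1981, §2 Prop. 6] [cite: MazurRubin2010, Cor. 3.4 (i)] -/
theorem meetsEgg_of_silent_selmerTrivial_twin_of_noRationalTwoTorsion (W : WeierstrassCurve ℚ) [W.IsElliptic] [W.IsGloballyMinimal]
    {K : Type} [Field K] [NumberField K] (hK : IsImaginaryQuadratic K) (hodd : Odd (discr K))
    (hH : SatisfiesHeegnerHypothesis (W.conductorNorm ℤ) K)
    (hΔ : 0 < W.Δ) (hT : NoRationalTwoTorsion W) (hrk : W.mordellWeilRank = 1) (hSel : Nat.card (W.selmerGroup 2) = 2)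
    {Wd : WeierstrassCurve ℚ} [Wd.IsElliptic] (Cd : VariableChange ℚ) (hWd : Cd • W.quadraticTwist (discr K : ℚ) = Wd)
    (hSil : padicValNat 2 Wd.tamagawaProduct = padicValNat 2 W.tamagawaProduct) (hSel1 : Nat.card (Wd.selmerGroup 2) = 1) :
    MeetsEgg W := by
  by_contra hegg
  have h4 := (natCard_selmerGroup_twin_of_silent_of_noRationalTwoTorsion W hK hodd hH hΔ hT hrk hSel Cd hWd hSil).2 hegg
  omega

/-! ## §3 The silent-prime twin package on the egg — no image hypothesis -/

/-- **THE SILENT-PRIME TWIN PACKAGE ON THE EGG, FOR EVERY IMAGE** (UNCONDITIONAL, rank currency).  `W/ℚ` globally minimal elliptic with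
`Δ_W > 0`, rank `1`, `#Sel₂(W) = 2`, MEETING THE EGG: there are a prime `ℓ` (`ℓ ≡ 7 (8)`, `ℓ ∤ N_W`, the `2`-division cubic ROOTLESS mod `ℓ`), the
prime Heegner field `K = ℚ(√−ℓ)` (`d_K = −ℓ` odd `≠ −3`, Heegner for `N_W`, `2` split, `d_K ≡ 1 (4)`) and a GLOBALLY MINIMAL model
`Wd ≅ W^{(d_K)}` with **`#Sel₂(Wd) = 1`**.  `W(ℚ)[2] = 0` comes from the descent count (§1); the silent prime from gk2-p4 g15's image-free
Čebotarev supply; the Selmer clause from §2.  = `Ledger.Line25.exists_silentPrime_heegnerField_selmerTrivialTwin_of_GZK` (p775371) minus GZK and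
minus `ρ̄_{W,2}` onto.  [cite: Kramer1981, §2 Props. 3, 6] [cite: MazurRubin2010, Cor. 3.4 (i)] [cite: SerreAbelianLadic1968, Ch. I §2.2, Cor. 2 (a)] -/
theorem exists_silentPrime_heegnerField_selmerTrivialTwin_of_meetsEgg
    (W : WeierstrassCurve ℚ) [W.IsElliptic] [W.IsGloballyMinimal]
    (hΔ : 0 < W.Δ) (hrk : W.mordellWeilRank = 1) (hSel : Nat.card (W.selmerGroup 2) = 2) (hegg : MeetsEgg W) :
    ∃ (K : Type) (_ : Field K) (_ : NumberField K) (ℓ : ℕ), ℓ.Prime ∧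
      IsImaginaryQuadratic K ∧ NumberField.discr K = -(ℓ : ℤ) ∧
      (∀ x : ZMod ℓ, 4 * x ^ 3 + ((integralModelInt W).b₂ : ZMod ℓ) * x ^ 2 +
        2 * ((integralModelInt W).b₄ : ZMod ℓ) * x + ((integralModelInt W).b₆ : ZMod ℓ) ≠ 0) ∧
      Odd (NumberField.discr K) ∧ NumberField.discr K ≠ -3 ∧ SatisfiesHeegnerHypothesis (W.conductorNorm ℤ) K ∧
      NumberField.discr K % 4 = 1 ∧ ((Ideal.span {(2 : ℤ)}).primesOver (𝓞 K)).ncard = 2 ∧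
      ∃ (Wd : WeierstrassCurve ℚ) (_ : Wd.IsElliptic) (_ : Wd.IsGloballyMinimal) (Cd : VariableChange ℚ),
        Cd • W.quadraticTwist (NumberField.discr K : ℚ) = Wd ∧ Nat.card (Wd.selmerGroup 2) = 1 := by
  have hT : NoRationalTwoTorsion W := noRationalTwoTorsion_of_natCard_selmerGroup_eq_two W hSel (le_of_eq hrk.symm)
  obtain ⟨ℓ, -, hℓ, -, -, hsil, -, K, iF, iN, hK, hd, hodd, h3, hH, h2K, -, -⟩ :=
    exists_silent_prime_heegnerField_of_noRationalTwoTorsion W hΔ hT 0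
  have hD0 : (NumberField.discr K : ℚ) ≠ 0 := by exact_mod_cast NumberField.discr_ne_zero K
  obtain ⟨Wd, iE, iM, Cd, hCd⟩ := exists_globallyMinimal_model_twist W hD0
  have hSil : padicValNat 2 Wd.tamagawaProduct = padicValNat 2 W.tamagawaProduct :=
    padicValNat_two_tamagawaProduct_twin_eq_of_discr_eq_neg_prime_of_noRoot W hK hodd hH hℓ hd hsil Cd hCd
  have hSelWd : Nat.card (Wd.selmerGroup 2) = 1 :=
    natCard_selmerGroup_twin_eq_one_of_meetsEgg_of_silent_of_noRationalTwoTorsion W hK hodd hH hΔ hT hrk hSel Cd hCd hSil hegg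
  exact ⟨K, iF, iN, ℓ, hℓ, hK, hd, hsil, hodd, h3, hH, Quadratic.discr_emod_four_eq_one hK.1 hodd, h2K, Wd, iE, iM, Cd, hCd, hSelWd⟩

/-- **The same from `r_an(W) = 1`** (mod GZK = item 19921 `rank_eq_analyticRank_of_analyticRank_le_one`, to turn `r_an = 1` into rank `1`).
CONDITIONAL on GZK only.  [cite: Kramer1981, §2 Prop. 6] [cite: Kolyvagin1989Izv, Thm. A] -/
theorem exists_silentPrime_heegnerField_selmerTrivialTwin_of_meetsEgg_of_GZK (hGZK : rank_eq_analyticRank_of_analyticRank_le_one)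
    (W : WeierstrassCurve ℚ) [W.IsElliptic] [W.IsGloballyMinimal]
    (hΔ : 0 < W.Δ) (hr : W.analyticRank = 1) (hSel : Nat.card (W.selmerGroup 2) = 2) (hegg : MeetsEgg W) :
    ∃ (K : Type) (_ : Field K) (_ : NumberField K) (ℓ : ℕ), ℓ.Prime ∧
      IsImaginaryQuadratic K ∧ NumberField.discr K = -(ℓ : ℤ) ∧
      (∀ x : ZMod ℓ, 4 * x ^ 3 + ((integralModelInt W).b₂ : ZMod ℓ) * x ^ 2 +
        2 * ((integralModelInt W).b₄ : ZMod ℓ) * x + ((integralModelInt W).b₆ : ZMod ℓ) ≠ 0) ∧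
      Odd (NumberField.discr K) ∧ NumberField.discr K ≠ -3 ∧ SatisfiesHeegnerHypothesis (W.conductorNorm ℤ) K ∧
      NumberField.discr K % 4 = 1 ∧ ((Ideal.span {(2 : ℤ)}).primesOver (𝓞 K)).ncard = 2 ∧
      ∃ (Wd : WeierstrassCurve ℚ) (_ : Wd.IsElliptic) (_ : Wd.IsGloballyMinimal) (Cd : VariableChange ℚ),
        Cd • W.quadraticTwist (NumberField.discr K : ℚ) = Wd ∧ Nat.card (Wd.selmerGroup 2) = 1 := by
  have hrk : W.mordellWeilRank = 1 := by rw [(hGZK W (le_of_eq hr)).1, hr]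
  exact exists_silentPrime_heegnerField_selmerTrivialTwin_of_meetsEgg W hΔ hrk hSel hegg

/-! ## §4 The egg engine at every Tamagawa depth — no image hypothesis -/

/-- **U₂ ON THE WHOLE EGG (`Δ > 0`, `MeetsEgg`), EVERY TAMAGAWA DEPTH, EVERY IMAGE, FROM THE WALL, THE RANK-ZERO 2-CONVERSE AND THE EXPONENT.**
Hypotheses: the four PRINT facts + the modular parametrisation (`hGZ`, `hGZK`, `hmod`, `hMilneC`, `hMP`); `hS1` = LINE 23's anchor S1 (BSD₂ for
non-CM rank-0 curves with `#Sel₂ = 1`); `hC0` = the rank-zero `2`-converse on all non-CM globally minimal curves; `hEXPpos` = EXP⁺_all WITHOUT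
the image clause: for `W` non-CM, `r_an = 1`, `#Sel₂ = 2`, `Δ > 0`, `MeetsEgg W`, at EVERY `K = ℚ(√−ℓ)` (`ℓ` prime, the `2`-division cubic
rootless mod `ℓ`, `d_K` odd `≠ −3`, Heegner) with `L(W^{(d_K)},1) ≠ 0` and EVERY conductor-`1` datum: `2^{ord₂ c + ord₂ C(W)} ∥ P(1)`.
CONCLUSION: `BSD₂(W)` for every non-CM globally minimal `W` with `r_an = 1`, `#Sel₂ = 2`, `Δ > 0`, `MeetsEgg W` — no Tamagawa cell, NO image
hypothesis.  = gk2-p2 g25's `AllDepth.bsdp_posDisc_egg_of_wall_of_converse_of_exponent_of_facts` (p776404 §2) with the silent-prime twin taken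
from §3.  CONDITIONAL on the displayed hypotheses; proves nothing about BSD; closes nothing.
[cite: GrossZagier1986, V.§2 (2.2)] [cite: Kramer1981, §2 Props. 3, 6] [cite: MazurRubin2010, Cor. 3.4 (i)] [cite: McCallumLMS1991, §5 Lemma 5.1]
[cite: Milne1972ArithmeticAV, §1 Thm. 1] [cite: Miller2011LMS, Def. 1.1] -/
theorem bsdp_posDisc_egg_of_wall_of_converse_of_exponent_of_facts_allImages
    (hGZ : ∀ (N : ℕ) [NeZero N] (W : WeierstrassCurve ℚ) (K : Type) [Field K] [NumberField K], gross_zagier N W K)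
    (hGZK : rank_eq_analyticRank_of_analyticRank_le_one) (hmod : hasEntireLFunction_rat)
    (hMilneC : Milne1972.bsdQuotient_baseChange_quadratic_anyModel) (hMP : nonempty_modularParametrizationData)
    (hS1 : ∀ (W : WeierstrassCurve ℚ) [W.IsElliptic] [W.IsGloballyMinimal],
      ¬ W.HasCM → W.analyticRank = 0 → Nat.card (W.selmerGroup 2) = 1 → BSDp W 2)
    (hC0 : ∀ (V : WeierstrassCurve ℚ) [V.IsElliptic] [V.IsGloballyMinimal], ¬ V.HasCM → V.selmerCorank 2 = 0 → V.analyticRank = 0)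
    (hEXPpos : ∀ (W : WeierstrassCurve ℚ) [W.IsElliptic] [W.IsGloballyMinimal] [NeZero (W.conductorNorm ℤ)],
      ¬ W.HasCM → W.analyticRank = 1 → Nat.card (W.selmerGroup 2) = 2 → 0 < W.Δ → MeetsEgg W →
      ∀ (K : Type) [Field K] [NumberField K], IsImaginaryQuadratic K →
        ∀ (ℓ : ℕ), ℓ.Prime → NumberField.discr K = -(ℓ : ℤ) →
        (∀ x : ZMod ℓ, 4 * x ^ 3 + ((integralModelInt W).b₂ : ZMod ℓ) * x ^ 2 +
            2 * ((integralModelInt W).b₄ : ZMod ℓ) * x + ((integralModelInt W).b₆ : ZMod ℓ) ≠ 0) →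
        Odd (NumberField.discr K) → NumberField.discr K ≠ -3 → SatisfiesHeegnerHypothesis (W.conductorNorm ℤ) K →
        (W.quadraticTwist (NumberField.discr K : ℚ)).entireLFunction 1 ≠ 0 →
        ∀ (Dt : ModularParametrizationData W (W.conductorNorm ℤ)) (β : ℤ) (ι : K →+* ℂ) (d₁ : KolyvaginHeegnerData Dt β ι 1),
          (∃ Q : (W.baseChange (ringClassField K ι 1)).toAffine.Point,
            ((2 ^ (padicValInt 2 Dt.c + padicValNat 2 W.tamagawaProduct) : ℕ) : ℤ) • Q = d₁.derivedPoint) ∧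
          (¬ ∃ Q : (W.baseChange (ringClassField K ι 1)).toAffine.Point,
            ((2 ^ (padicValInt 2 Dt.c + padicValNat 2 W.tamagawaProduct + 1) : ℕ) : ℤ) • Q = d₁.derivedPoint)) :
    ∀ (W : WeierstrassCurve ℚ) [W.IsElliptic] [W.IsGloballyMinimal], ¬ W.HasCM → W.analyticRank = 1 →
      Nat.card (W.selmerGroup 2) = 2 → 0 < W.Δ → MeetsEgg W → BSDp W 2 := by
  intro W _ _ hcm hr hSel hΔ hegg
  haveI : NeZero (W.conductorNorm ℤ) := ⟨(W.conductorNorm_pos_holds).ne'⟩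
  -- the silent prime Heegner field with its globally minimal Sel₂-trivial twin (the egg decides; no image hypothesis), costing no Tamagawa bit
  obtain ⟨K, _, _, ℓ, hℓ, hK, hd, hsil, hodd, h3, hH, -, -, Wd, _, _, Cd, hCd, hSel1⟩ :=
    exists_silentPrime_heegnerField_selmerTrivialTwin_of_meetsEgg_of_GZK hGZK W hΔ hr hSel hegg
  have hD0 : (NumberField.discr K : ℚ) ≠ 0 := by exact_mod_cast NumberField.discr_ne_zero K
  haveI := W.isElliptic_quadraticTwist hD0
  have hSil : padicValNat 2 Wd.tamagawaProduct = padicValNat 2 W.tamagawaProduct :=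
    padicValNat_two_tamagawaProduct_twin_eq_of_discr_eq_neg_prime_of_noRoot W hK hodd hH hℓ hd hsil Cd hCd
  -- the central value through the rank-zero 2-converse
  have hL : (W.quadraticTwist (NumberField.discr K : ℚ)).entireLFunction 1 ≠ 0 :=
    entireLFunction_twist_one_ne_zero_of_rankZeroTwoConverse_of_natCard_selmerGroup_eq_one hC0 hmod W hcm hD0 Wd hCd hSel1
  -- a conductor-1 datum, its Heegner point of infinite order, and the exponent
  obtain ⟨Dt, β, ι, d₁, hc0⟩ := exists_kolyvaginHeegnerData_one_of_nonempty_modularParametrizationData hMP W K hK hH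
  have hy : ¬ IsOfFinAddOrder d₁.derivedPoint :=
    not_isOfFinAddOrder_derivedPoint_one_of_rankOne_of_lValue_ne_zero hmod W K (hGZ _ W K) hK hH hr hL d₁
  obtain ⟨hdiv, hndiv⟩ := hEXPpos W hcm hr hSel hΔ hegg K hK ℓ hℓ hd hsil hodd h3 hH hL Dt β ι d₁
  -- the twin is non-CM of analytic rank 0: `BSD₂(Wd)` from the wall
  have hcmd : ¬ Wd.HasCM := by
    rw [← hCd, hasCM_iff_of_j_eq (((W.quadraticTwist (NumberField.discr K : ℚ)).variableChange_j Cd).trans (W.j_quadraticTwist hD0))]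
    exact hcm
  have hrd : Wd.analyticRank = 0 := by
    rw [← hCd, analyticRank_smul]
    exact ((W.quadraticTwist (NumberField.discr K : ℚ)).analyticRank_eq_zero_iff_holds (hmod _)).mpr hL
  have hBd : BSDp Wd 2 := hS1 Wd hcmd hrd hSel1
  exact swappedPairDescentAtTwo_silent_of_facts hGZ hGZK hmod hMilneC W hr hSel K hK hodd h3 hH Dt hc0 β ι d₁ hy hdiv hndiv
    Wd ⟨Cd, hCd⟩ hSel1 hSil hBd

end Summit.BirchSwinnertonDyer.BirchSwinnertonDyer.Theorems.GenusExact.TwinSwap.EggAllImages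

end
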